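import Mathlib
import Summits.NavierStokesRegularity.NavierStokesRegularity.Theorems.EulerZoomLiouvillePowerGaugeEulerLiouvilleWeakSupportDensityLimit
import Summits.NavierStokesRegularity.NavierStokesRegularity.Theorems.EulerZoomLiouvillePowerGaugeEulerLiouvilleWeakSupportDensityLaw
import Summits.NavierStokesRegularity.NavierStokesRegularity.Theorems.EulerZoomLiouvillePowerGaugeEulerLiouvilleNeedleVorticityDensity
import Summits.NavierStokesRegularity.NavierStokesRegularity.Theorems.EulerZoomLiouvillePowerGaugeEulerLiouvilleSelfSimilarVorticity
import Summits.NavierStokesRegularity.NavierStokesRegularity.Theorems.EulerZoomLiouvillePowerGaugeEulerLiouvilleSelfSimilarGauges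
import HarnessLib

/-!
# Crux `EulerZoomLiouville.PowerGaugeEulerLiouville` (stmt-NavierStokesRegularity-19832): THE SUPPORT-DENSITY FLOOR
# — ROUND-53 «THE FLOOR» (nsreg-p2 g43) plate (F3a) `NsregP2.R53.Floor.SupportDensityFloor ρ V` VERBATIM, every `ρ > 0`

Route №10 `EulerZoomLiouville` (NavierStokesRegularity), crux E = stmt-NavierStokesRegularity-19832; LEAD ns-typeII-p2 g15.
The `q = 0` anchor of THE FLOOR: for a classical self-similar Euler profile `(V,P)` at the rate `γ = 1/(2+ρ)` with the `A`-gauge growth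
`∫_{B_R}‖V‖² ≤ A R^{1−2ρ}` (`R ≥ 1`), the vortical set `S = {curl V ≠ 0}` obeys the SUPPORT LAW (`NeedleDigest.renormalisedVorticity_classical` ⇒
ns-ezl-w1 g8's `WeakEulerian.supportLaw_of_renormalised` at `G = DV`), hence (`WeakEulerian.exists_tendsto_sharpDensity`,
`WeakEulerian.measure_eq_zero_of_tendsto_sharpDensity_zero` of `…WeakSupportDensityLimit`):

* `Floor.supportDensity_dichotomy` — **the vortical set has an asymptotic density `d = lim vol(S ∩ B_R)/R³ ≥ 0`, and `d = 0` forces `curl V ≡ 0`**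
  (`S` is open, so null ⇒ empty);
* `Floor.supportDensityFloor` — ★ **(F3a) `SupportDensityFloor ρ V`** of `r53/Sketch53.lean` (sha16 b1e8e5c022b4e08e, l.104–109), δ-free (it mentions no
  R53 definition): a budget-class profile with `curl V ≢ 0` has `vol({curl V ≠ 0} ∩ B_R) ≥ c₀R³` for all large `R` (`c₀ = d/2`); the E-budget
  hypothesis of the plate is idle;
* `NeedleDigest.vorticity_support_density` — the needle-digest form over the crux binders (`InClass`, exact self-similarity, `V ∈ C²`, member not a.e.
  zero): **the vorticity support has a POSITIVE DENSITY `d₀ = lim_{R→∞} vol({curl V ≠ 0} ∩ B_R)/R³ > 0`** — the LIMIT sharpening of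
  `NeedleDigest.vorticity_support_upper_density` (`¬ density → 0`, p699826): the vortical cells of a surviving `C²` needle occupy a fixed positive
  fraction `d₀/|B₁|` of EVERY large ball, not only along a sequence.
[folklore; DiPernaLions1989 §II; the `q = 0` end of ChaeShvydkoy2013 §4 eq. (4.2); nsreg-p2 R53 §2 (F3a)]

WHAT THIS IS NOT: not NS, not E, not a member — an instrument (two-sided portrait of a HYPOTHETICAL survivor; kills nothing); 19832 OPEN.
-/

noncomputable section

-- flat `Theorems/<Route><Decl>…` files of one crux share the namespace of the crux (tree convention)
set_option linter.dupNamespace false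

open MeasureTheory Set Filter Topology Metric Function TopologicalSpace
open scoped ENNReal NNReal ContDiff

namespace Summit.NavierStokesRegularity.NavierStokesRegularity.Theorems.PowerGaugeEulerLiouville

open Literature.Analysis Literature.Analysis.FunctionSpaces Literature.Analysis.FluidPDE

namespace Floor

/-- **THE VORTICAL SET OF A BUDGET PROFILE HAS A DENSITY; the profile is irrotational unless that density is positive.**  `ρ > 0`,
`(V,P)` a classical self-similar Euler profile at rate `1/(2+ρ)` about `0`, `∫_{B_R}‖V‖² ≤ A R^{1−2ρ}` for `R ≥ 1` ⇒ there is `d ≥ 0` with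
`vol({curl V ≠ 0} ∩ B_R)/R³ → d`, and `d = 0 ⇒ curl V ≡ 0`. -/
theorem supportDensity_dichotomy {ρ : ℝ} (hρ : 0 < ρ)
    {V : EuclideanSpace ℝ (Fin 3) → EuclideanSpace ℝ (Fin 3)} {P : EuclideanSpace ℝ (Fin 3) → ℝ}
    (hprof : IsSelfSimilarEulerProfile (1 / (2 + ρ)) 0 V P)
    {A : ℝ} (hA : ∀ R : ℝ, 1 ≤ R → ∫ y in ball (0 : EuclideanSpace ℝ (Fin 3)) R, ‖V y‖ ^ 2 ≤ A * R ^ (1 - 2 * ρ)) :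
    ∃ d : ℝ, 0 ≤ d ∧
      Tendsto (fun R : ℝ => (volume ({y : EuclideanSpace ℝ (Fin 3) | curl V y ≠ 0} ∩ ball (0 : EuclideanSpace ℝ (Fin 3)) R)).toReal / R ^ 3)
        atTop (𝓝 d) ∧
      (d = 0 → ∀ y, curl V y = 0) := by
  have hV : ContDiff ℝ 2 V := hprof.contDiff_velocity
  have hγ : (0 : ℝ) < 1 / (2 + ρ) := by positivity
  have hVl : LocallyIntegrable V volume := hV.continuous.locallyIntegrable
  have hDVc : Continuous (fderiv ℝ V) := hV.continuous_fderiv (by norm_num)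
  have hGl : LocallyIntegrable (fderiv ℝ V) volume := hDVc.locallyIntegrable
  have hV2 : ∀ r : ℝ, MemLp V 2 (volume.restrict (ball (0 : EuclideanSpace ℝ (Fin 3)) r)) := fun r =>
    NeedleDigest.memLp_ball_of_continuous hV.continuous r 2
  have hA0 : 0 ≤ A := by
    have h := hA 1 le_rfl
    have h0 : 0 ≤ ∫ y in ball (0 : EuclideanSpace ℝ (Fin 3)) 1, ‖V y‖ ^ 2 := integral_nonneg fun _ => by positivity
    rw [Real.one_rpow, mul_one] at h
    linarith
  have hA2 : ∀ L : ℝ, 2 ≤ L → ∫ y in ball (0 : EuclideanSpace ℝ (Fin 3)) L, ‖V y‖ ^ 2 ≤ A * L ^ (1 - 2 * ρ) :=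
    fun L hL => hA L (by linarith)
  -- ### the vortical set is open
  have hcurl : ∀ y, curlCLM (fderiv ℝ V y) = curl V y := fun y => rfl
  have hΩc : Continuous (curl V) := by
    have e : curl V = fun y => curlCLM (fderiv ℝ V y) := funext fun y => (hcurl y).symm
    rw [e]
    exact curlCLM.continuous.comp hDVc
  set S : Set (EuclideanSpace ℝ (Fin 3)) := {y : EuclideanSpace ℝ (Fin 3) | curl V y ≠ 0} with hS
  have hSo : IsOpen S := isOpen_ne_fun hΩc continuous_const
  have hSm : MeasurableSet S := hSo.measurableSet
  -- ### the classical vorticity is renormalised ⇒ the support law for `S`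
  have hren : ∀ β : EuclideanSpace ℝ (Fin 3) → ℝ, ContDiff ℝ 1 β →
      (∃ C : ℝ, ∀ w : EuclideanSpace ℝ (Fin 3), ‖β w‖ ≤ C ∧ ‖fderiv ℝ β w‖ ≤ C) →
      ∀ ψ : EuclideanSpace ℝ (Fin 3) → ℝ, IsTestFunctionOn (⊤ : Opens (EuclideanSpace ℝ (Fin 3))) ψ →
        ∫ y, β (curlCLM (fderiv ℝ V y)) * (3 * (1 / (2 + ρ)) * ψ y + fderiv ℝ ψ y (selfSimilarTransport (1 / (2 + ρ)) 0 V y)) =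
          ∫ y, ψ y * fderiv ℝ β (curlCLM (fderiv ℝ V y))
            (curlCLM (fderiv ℝ V y) - fderiv ℝ V y (curlCLM (fderiv ℝ V y))) := by
    intro β hβ _ ψ hψ
    simp only [hcurl]
    exact NeedleDigest.renormalisedVorticity_classical hprof β hβ ψ hψ
  have hlaw : ∀ ψ : EuclideanSpace ℝ (Fin 3) → ℝ, IsTestFunctionOn (⊤ : Opens (EuclideanSpace ℝ (Fin 3))) ψ →
      ∫ y in S, (3 * (1 / (2 + ρ)) * ψ y + fderiv ℝ ψ y (selfSimilarTransport (1 / (2 + ρ)) 0 V y)) = 0 := by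
    intro ψ hψ
    have h := WeakEulerian.supportLaw_of_renormalised (γ := 1 / (2 + ρ)) hVl hGl hren hψ
    rw [← integral_indicator hSm, ← h]
    refine integral_congr_ae (Eventually.of_forall fun y => ?_)
    dsimp only
    by_cases hyS : y ∈ S
    · rw [indicator_of_mem hyS]
      have hne : curlCLM (fderiv ℝ V y) ≠ 0 := hyS
      rw [if_neg hne, one_mul]
    · rw [indicator_of_notMem hyS]
      have heq : curlCLM (fderiv ℝ V y) = 0 := by
        by_contra h'
        exact hyS h'
      rw [if_pos heq, zero_mul]
  -- ### the density exists; zero density ⇒ `S` null ⇒ `S = ∅`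
  obtain ⟨d, hd0, hd⟩ := WeakEulerian.exists_tendsto_sharpDensity hγ hρ hVl hV2 hA0 hA2 hlaw
  refine ⟨d, hd0, hd, fun hd_zero y => ?_⟩
  rw [hd_zero] at hd
  have hnull := WeakEulerian.measure_eq_zero_of_tendsto_sharpDensity_zero hγ hρ hVl hV2 hA0 hA2 hlaw hd
  by_contra hy
  exact (hSo.measure_pos volume ⟨y, hy⟩).ne' hnull

/-- ★ **(F3a) THE SUPPORT-DENSITY FLOOR — `NsregP2.R53.Floor.SupportDensityFloor ρ V` VERBATIM, every `ρ > 0`.**  A budget-class classical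
self-similar Euler profile whose vorticity does not vanish identically has vortical support of POSITIVE LOWER DENSITY: `c₀R³ ≤ vol({curl V ≠ 0} ∩ B_R)`
for all `R ≥ R₀` (`c₀ = d/2`, `d > 0` the density of `supportDensity_dichotomy`).  The weighted-enstrophy (E-budget) hypothesis is not used.
[nsreg-p2 R53 (F3a); folklore] -/
theorem supportDensityFloor {ρ : ℝ} (hρ : 0 < ρ) {V : EuclideanSpace ℝ (Fin 3) → EuclideanSpace ℝ (Fin 3)} :
    ∀ P : EuclideanSpace ℝ (Fin 3) → ℝ, IsSelfSimilarEulerProfile (1 / (2 + ρ)) 0 V P →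
    (∫⁻ y, ‖fderiv ℝ V y‖ₑ ^ 2 * ENNReal.ofReal (‖y‖ ^ (ρ - 1))) ≠ ⊤ →
    (∃ A : ℝ, ∀ R : ℝ, 1 ≤ R →
      ∫ y in Metric.ball (0 : EuclideanSpace ℝ (Fin 3)) R, ‖V y‖ ^ 2 ≤ A * R ^ (1 - 2 * ρ)) →
      (∃ y, curl V y ≠ 0) → ∃ c₀ R₀ : ℝ, 0 < c₀ ∧ ∀ R : ℝ, R₀ ≤ R →
        c₀ * R ^ (3 : ℝ) ≤
          (volume ({y : EuclideanSpace ℝ (Fin 3) | curl V y ≠ 0} ∩ Metric.ball (0 : EuclideanSpace ℝ (Fin 3)) R)).toReal := by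
  intro P hprof _ hA hne
  obtain ⟨A, hA⟩ := hA
  obtain ⟨y₀, hy₀⟩ := hne
  obtain ⟨d, hd0, hd, hdich⟩ := supportDensity_dichotomy hρ hprof hA
  have hdpos : 0 < d := lt_of_le_of_ne hd0 fun h => hy₀ (hdich h.symm y₀)
  have hev : ∀ᶠ R in atTop, d / 2 <
      (volume ({y : EuclideanSpace ℝ (Fin 3) | curl V y ≠ 0} ∩ ball (0 : EuclideanSpace ℝ (Fin 3)) R)).toReal / R ^ 3 :=
    hd.eventually_const_lt (half_lt_self hdpos)
  obtain ⟨R₀, hR₀⟩ := (hev.and (eventually_gt_atTop (0 : ℝ))).exists_forall_of_atTop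
  refine ⟨d / 2, R₀, half_pos hdpos, fun R hR => ?_⟩
  obtain ⟨h1, hR0⟩ := hR₀ R hR
  rw [Real.rpow_ofNat]
  exact ((lt_div_iff₀ (pow_pos hR0 3)).1 h1).le

end Floor

namespace NeedleDigest

/-- **A NONTRIVIAL `C²` NEEDLE HAS VORTICITY SUPPORT OF POSITIVE DENSITY — as a LIMIT.**  Crux binders verbatim, `0 < ρ ≤ ½`, exact self-similarity
about the origin with profile `(V,P)`, `V ∈ C²`, member NOT a.e. zero ⇒ `vol({curl V ≠ 0} ∩ B_R)/R³ → d₀ > 0`: the vortical cells occupy the fixed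
positive fraction `d₀/|B₁|` of every large ball (sharpening `vorticity_support_upper_density`, which only denied `density → 0`).  Proof: classical
pressure (`WeakToClassical.exists_isSelfSimilarEulerProfile_of_contDiff`), `A`-growth from the gauge (`profile_energy_growth_of_gaugeA`),
`Floor.supportDensity_dichotomy`; `d₀ = 0` would make the profile irrotational, hence the member trivial (`selfSimilar_ae_eq_zero_of_hasCompactSupport_curl`).
[folklore; DiPernaLions1989 Thm II.1; ChaeShvydkoy2013 §4] -/
theorem vorticity_support_density {ρ : ℝ} (hρ : 0 < ρ) (hρ1 : ρ ≤ 1 / 2)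
    {u : ℝ → EuclideanSpace ℝ (Fin 3) → EuclideanSpace ℝ (Fin 3)} {p : ℝ → EuclideanSpace ℝ (Fin 3) → ℝ}
    {H : ℝ → EuclideanSpace ℝ (Fin 3) → EuclideanSpace ℝ (Fin 3) →L[ℝ] EuclideanSpace ℝ (Fin 3)} {c : ℝ≥0}
    (hsw : IsSuitableWeakSolutionOn (slab (EuclideanSpace ℝ (Fin 3)) (Iio 0) isOpen_Iio) 0 0 u p)
    (hH : HasWeakSpatialGradientOn (slab (EuclideanSpace ℝ (Fin 3)) (Iio 0) isOpen_Iio) u H)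
    (hgauge : ∀ a : ℝ, 0 < a →
      ENNReal.ofReal (a ^ (2 * ρ)) * cknA a (0 : ℝ × EuclideanSpace ℝ (Fin 3)) u +
          ENNReal.ofReal (a ^ ρ) * cknE a (0 : ℝ × EuclideanSpace ℝ (Fin 3)) H +
        ENNReal.ofReal (a ^ (2 * ρ)) * cknD a (0 : ℝ × EuclideanSpace ℝ (Fin 3)) p ≤ (c : ℝ≥0∞))
    {V : EuclideanSpace ℝ (Fin 3) → EuclideanSpace ℝ (Fin 3)} {P : EuclideanSpace ℝ (Fin 3) → ℝ}
    (hu : ∀ τ : ℝ, τ < 0 → u τ = selfSimilarCollapse (1 / (2 + ρ)) 0 V τ)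
    (hp : ∀ τ : ℝ, τ < 0 → p τ = selfSimilarCollapsePressure (1 / (2 + ρ)) 0 P τ)
    (hV : ContDiff ℝ 2 V)
    (hnt : ¬ (uncurry u =ᵐ[volume.restrict (Iio (0 : ℝ) ×ˢ (univ : Set (EuclideanSpace ℝ (Fin 3))))] 0)) :
    ∃ d₀ : ℝ, 0 < d₀ ∧
      Tendsto (fun R : ℝ => (volume ({y : EuclideanSpace ℝ (Fin 3) | curl V y ≠ 0} ∩ ball (0 : EuclideanSpace ℝ (Fin 3)) R)).toReal / R ^ 3)
        atTop (𝓝 d₀) := by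
  have hρ1' : ρ < 1 := by linarith
  -- ### a classical pressure for the profile (as in `vorticity_support_upper_density`)
  have hD : ∀ a : ℝ, 0 < a → ENNReal.ofReal (a ^ (2 * ρ)) *
      cknD a (0 : ℝ × EuclideanSpace ℝ (Fin 3)) p ≤ (c : ℝ≥0∞) :=
    fun a ha => le_trans le_add_self (hgauge a ha)
  have hA : ∀ a : ℝ, 0 < a → ENNReal.ofReal (a ^ (2 * ρ)) *
      cknA a (0 : ℝ × EuclideanSpace ℝ (Fin 3)) u ≤ (c : ℝ≥0∞) :=
    fun a ha => le_trans (le_trans le_self_add le_self_add) (hgauge a ha)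
  have hpm : AEStronglyMeasurable (uncurry p)
      (volume.restrict (Iio (0 : ℝ) ×ˢ (univ : Set (EuclideanSpace ℝ (Fin 3))))) := by
    have := hsw.distributional.2.2.1.aestronglyMeasurable
    simpa [slab] using this
  have hPm := aestronglyMeasurable_pressureProfile hpm hp
  have hDprof := profile_pressure_weight_of_gaugeD hρ hρ1' hpm hp hD
  have hP1 : LocallyIntegrable P volume :=
    EnergySaturation.locallyIntegrable_pressure_of_weight hρ1' hPm
      (ENNReal.mul_ne_top ENNReal.ofReal_ne_top ENNReal.coe_ne_top) hDprof
  obtain ⟨P', hprof⟩ :=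
    WeakToClassical.exists_isSelfSimilarEulerProfile_of_contDiff hsw.distributional hu hp hV hP1
  -- ### the `A`-growth of the profile in real form
  have hV2 : ∀ r : ℝ, MemLp V 2 (volume.restrict (ball (0 : EuclideanSpace ℝ (Fin 3)) r)) := fun r =>
    memLp_ball_of_continuous hV.continuous r 2
  have hgr := profile_energy_growth_of_gaugeA hρ hu hA
  have hAreal : ∀ R : ℝ, 1 ≤ R →
      ∫ y in ball (0 : EuclideanSpace ℝ (Fin 3)) R, ‖V y‖ ^ 2 ≤ (c : ℝ) * R ^ (1 - 2 * ρ) := by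
    intro R hR
    have hint : IntegrableOn (fun y => ‖V y‖ ^ 2) (ball (0 : EuclideanSpace ℝ (Fin 3)) R) volume :=
      (hV2 R).integrable_norm_pow two_ne_zero
    have e : ∫ y in ball (0 : EuclideanSpace ℝ (Fin 3)) R, ‖V y‖ ^ 2 =
        (∫⁻ y in ball (0 : EuclideanSpace ℝ (Fin 3)) R, ‖V y‖ₑ ^ 2).toReal := by
      rw [integral_eq_lintegral_of_nonneg_ae (Eventually.of_forall fun y => by positivity) hint.aestronglyMeasurable]
      congr 1
      refine lintegral_congr fun y => ?_
      rw [← ofReal_norm, ENNReal.ofReal_pow (norm_nonneg _)]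
    rw [e, ← ENNReal.coe_toReal c, ← ENNReal.toReal_ofReal (by positivity : 0 ≤ R ^ (1 - 2 * ρ)), ← ENNReal.toReal_mul]
    exact ENNReal.toReal_mono (ENNReal.mul_ne_top ENNReal.coe_ne_top ENNReal.ofReal_ne_top) (hgr R (by linarith))
  -- ### the dichotomy; the irrotational branch is excluded by non-triviality
  obtain ⟨d, hd0, hd, hdich⟩ := Floor.supportDensity_dichotomy hρ hprof hAreal
  refine ⟨d, lt_of_le_of_ne hd0 fun h => hnt ?_, hd⟩
  have hcurl0 : curl V = 0 := funext (hdich h.symm)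
  have hΩc : HasCompactSupport (curl V) := by
    rw [hcurl0]
    exact HasCompactSupport.zero
  exact selfSimilar_ae_eq_zero_of_hasCompactSupport_curl hρ u p H c V P' hsw hH hgauge hu hprof hΩc

end NeedleDigest

end Summit.NavierStokesRegularity.NavierStokesRegularity.Theorems.PowerGaugeEulerLiouville
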